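import Mathlib
import Summits.CriticalPhenomena.PercolationContinuityZ3.Theorems.PercNearOneGluingNoHeavyLowerTailOrderedDifferencesEigen

/-!
# Bad parameters of the Marica–Schönheim pencil are algebraic units (every characteristic)

Helper file for crux `stmt-CriticalPhenomena-4575` (`NoHeavyLowerTail`, route `PercNearOneGluingNoHeavy`),
new-inequality factory seat `prim-ineq-gen-3` (gen 24).  Everything here is PROVED; no definitions.

Corollary of `…OrderedDifferencesEigen` (`exists_intMatrix_pair_vecMul`: two integer matrices `G, H` with `c · G = -t · c` and
`t · (c · H) = -c` for every dependency `c` of the pencil rows at `t`, over every field):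

* `isIntegral_of_pencil_dependent` — if the pencil rows `A ↦ (E ↦ [E ⊆ A] + t [E ∩ A = ∅])` of a finite family are linearly dependent
  over a field `K` at `t`, then `t ≠ 0` and both `t` and `t⁻¹` are integral over `ℤ`.  Over `ℚ` this recovers gen 20's `t = ±1`; over a
  number field a bad `t` is a unit of the ring of integers (conjecture (C0): it is `±1`); over a finite field it carries no information —
  and indeed the Fano plane is singular over `ZMod 7` at `t = 3` (`…OrderedDifferencesFano`).
(prim-ineq-gen-3 gen 24, 2026-08-24; memo `THEOREM-COKERNEL.md`.)
-/

namespace Summit.CriticalPhenomena.PercolationContinuityZ3.Theorems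

namespace OrderedDifferences

open Finset Matrix Polynomial
open scoped FinsetFamily

universe u

variable {α : Type*} [DecidableEq α]

/-- **Bad `t` are algebraic units (every characteristic).**  If the pencil rows of `𝒜` are linearly dependent over a field `K` at `t`,
then `t ≠ 0` and both `t` and `t⁻¹` are integral over `ℤ` (roots of monic integer polynomials — the characteristic polynomials of the two
integer matrices of `exists_intMatrix_pair_vecMul`).  Over `ℚ` this is the gen-20 theorem `t = ±1`; over a number field it says that a bad `t`
is a UNIT of its ring of integers; conjecture (C0) (memo `CONJECTURE-P2.md` §24) says it is `±1`. -/
theorem isIntegral_of_pencil_dependent (𝒜 : Finset (Finset α)) (K : Type u) [Field K] (t : K)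
    (h : ¬ LinearIndependent K (fun A : 𝒜 => fun E : (𝒜 \\ 𝒜 : Finset (Finset α)) =>
      (if (E : Finset α) ⊆ (A : Finset α) then (1 : K) else 0) +
        t * (if Disjoint (E : Finset α) (A : Finset α) then (1 : K) else 0))) :
    t ≠ 0 ∧ IsIntegral ℤ t ∧ IsIntegral ℤ t⁻¹ := by
  classical
  obtain ⟨G, H, hGH⟩ := exists_intMatrix_pair_vecMul 𝒜
  rw [Fintype.not_linearIndependent_iff] at h
  obtain ⟨c, hc, i, hi⟩ := h
  have hc0 : c ≠ 0 := fun h => hi (by rw [h]; rfl)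
  obtain ⟨hG, hH⟩ := hGH K t c hc
  -- `t ≠ 0`: otherwise `-c = t • (c H) = 0`
  have ht0 : t ≠ 0 := by
    intro h0
    apply hc0
    have : -c = 0 := by rw [← hH, h0, zero_smul]
    exact neg_eq_zero.mp this
  -- an eigenvalue `s` of an integer matrix `N` (with non-zero left eigenvector) is a root of its characteristic polynomial
  have root : ∀ (N : Matrix 𝒜 𝒜 ℤ) (s : K), c ᵥ* N.map (Int.castRingHom K) = s • c →
      aeval s N.charpoly = 0 := by
    intro N s hs
    set N' : Matrix 𝒜 𝒜 K := N.map (Int.castRingHom K) with hN'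
    have hsc : c ᵥ* Matrix.scalar (↥𝒜) s = s • c := by
      ext j
      simp [Matrix.scalar_apply, Matrix.vecMul_diagonal, mul_comm]
    have hker : c ᵥ* (Matrix.scalar (↥𝒜) s - N') = 0 := by
      rw [Matrix.vecMul_sub, hs, hsc, sub_self]
    have hdet : (Matrix.scalar (↥𝒜) s - N').det = 0 :=
      (Matrix.exists_vecMul_eq_zero_iff).mp ⟨c, hc0, hker⟩
    have hmap : N'.charpoly = N.charpoly.map (Int.castRingHom K) := by
      rw [hN']; exact Matrix.charpoly_map N (Int.castRingHom K)
    rw [Polynomial.aeval_def, ← Polynomial.eval_map, algebraMap_int_eq, ← hmap, Matrix.eval_charpoly]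
    exact hdet
  have hIt : IsIntegral ℤ (-t) := ⟨G.charpoly, Matrix.charpoly_monic G, root G (-t) hG⟩
  have hH' : c ᵥ* H.map (Int.castRingHom K) = (-t⁻¹) • c := by
    have e : t⁻¹ • (t • (c ᵥ* H.map (Int.castRingHom K))) = t⁻¹ • (-c) := by rw [hH]
    rw [smul_smul, inv_mul_cancel₀ ht0, one_smul] at e
    rw [e, smul_neg, neg_smul]
  have hIti : IsIntegral ℤ (-t⁻¹) := ⟨H.charpoly, Matrix.charpoly_monic H, root H (-t⁻¹) hH'⟩
  refine ⟨ht0, ?_, ?_⟩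
  · have := hIt.neg; rwa [neg_neg] at this
  · have := hIti.neg; rwa [neg_neg] at this

end OrderedDifferences

end Summit.CriticalPhenomena.PercolationContinuityZ3.Theorems
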